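import Summits.QuantumAdvantage.QuantumAdvantage.Theorems.LocusDialPieces

/-!
# StabilizerDial — part «Gauge» (cell decomp-qadv, seat lens-2, generation 17; supports item 26531 `ExactnessDial.PolyLossOddU3`)

§1–§7 of the g17 node «StabilizerDial» (HOME decomp-qadv-lens-2/g17/StabilizerDial.lean, record NODE-g17.md),
re-namespaced to `…Theorems.StabilizerDial`.  THE STABILIZER GAUGE of the ring relation: the `𝔽₂`-row space of the
game matrix `M(x) = A_{Cₙ} + diag(x)` fixes `RingHLF.Rel x ·` for EVERY input (`rel_rowPad_iff`; `M(x)` symmetric, so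
`⟨v, M(x)β⟩ = ⟨M(x)v, β⟩ = 0` on the kernel); at polynomial level `pad P s` (degree `2·deg P + 6·deg s + 1`, same
win set `winset_pad`, `dev (pad P s) x = dev P x △ M(x)s(x)`).  Consequences: (i) the COLLAPSE of g16's generic piece,
`manyLocusLoss3_iff : LocusDial.ManyLocusLoss3 ⟺ ExactnessDial.PolyLossOddU3` (critic 69v16 as a theorem: pad by the
constant comb gauge; negative knowledge for every dichotomy by a gauge-destructible property of the bet); (ii) the
gauge-SATURATED class `StabFew m r e` (some degree-`(log₂ n)^e` gauge makes the bet `(m, r)`-few-locus), closed under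
padding in both directions up to one notch (`stabFew_of_stabFew_pad`, `stabFew_pad_of_stabFew`); (iii) the node
`node_iff : PolyLossOddU3 ⟺ LocusDial.FewLocusLoss3 ∧ StabGenericLoss3` with `closes : FewLocusLoss3 →
StabGenericLoss3 → DPLift3 → AdviceFreeQNC0Three` BY NAME via `HolonomyDial.closes_T`; (iv) witnesses that the
saturation is real (`stabFew_pad_tPoly_comb` vs `not_fewLocus_pad_tPoly_comb`) and the Prop-level targets
`AcGeneric3` (generic-class witness), `StabGenericConst3` (`G⁺`, with `G⁺ → G`).  Prop definitions = the node's pieces /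
targets only.  No `sorry`; standard axioms; no instances, no notation.
-/

set_option linter.dupNamespace false

noncomputable section

open scoped Classical

namespace Summit.QuantumAdvantage.QuantumAdvantage.Theorems.StabilizerDial

open Finset
open Literature.Computability.QuantumComplexity Literature.Computability.QuantumComplexity.RingHLF
open Literature.Computability.MetaComplexity Literature.Computability.MetaComplexity.Smolensky
open Summit.QuantumAdvantage.AdviceFreeQNC0
open Summit.QuantumAdvantage.QuantumAdvantage.Theses (ExactnessDial.PolyLossOddU3 ExactnessDial.DPLift3)
open Summit.QuantumAdvantage.QuantumAdvantage.Theorems.HolonomyDial (gCond selP selP_mem selP_apply xorP xorP_mem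
  xorP_apply_bool tPoly tPoly_mem tPoly_apply mono_singleton_apply closes_T card_odd_le)
open Summit.QuantumAdvantage.QuantumAdvantage.Theorems.AnchorDial (outB dev win_iff loss_shape_mono card_odd_ge)
open Summit.QuantumAdvantage.QuantumAdvantage.Theorems.LocusDial (Coverable FewLocus FewLocusLoss3 ManyLocusLoss3
  fewLocusLoss3_of_polyLossOddU3 manyLocusLoss3_of_polyLossOddU3 Coverable.card_le coverable_empty dev_tPoly
  fewLocus_tPoly acStrat dev_acStrat not_fewLocus_acStrat)

variable {N : ℕ}

/-! ## §1  The STABILIZER GAUGE over `𝔽₂`: rows of `M(x) = A_{Cₙ} + diag(x)` preserve `Rel x ·` for EVERY input -/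

/-- `𝔽₂`-reading of a bit. -/
def toZ (b : Bool) : ZMod 2 := if b then 1 else 0

/-- StabilizerDialGaugeA helper `toZ_true` (decomp-qadv land package; see the module docstring). -/
@[simp] theorem toZ_true : toZ true = 1 := rfl
/-- StabilizerDialGaugeA helper `toZ_false` (decomp-qadv land package; see the module docstring). -/
@[simp] theorem toZ_false : toZ false = 0 := rfl

/-- StabilizerDialGaugeA helper `toZ_xor` (decomp-qadv land package; see the module docstring). -/
theorem toZ_xor (p q : Bool) : toZ (xor p q) = toZ p + toZ q := by
  cases p <;> cases q <;> decide

/-- StabilizerDialGaugeA helper `toZ_and` (decomp-qadv land package; see the module docstring). -/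
theorem toZ_and (p q : Bool) : toZ (p && q) = toZ p * toZ q := by
  cases p <;> cases q <;> decide

/-- StabilizerDialGaugeA helper `toZ_and_xor` (decomp-qadv land package; see the module docstring). -/
theorem toZ_and_xor (a p q : Bool) : toZ (a && xor p q) = toZ (a && p) + toZ (a && q) := by
  cases a <;> cases p <;> cases q <;> decide

/-- StabilizerDialGaugeA helper `ite_and_eq_toZ` (decomp-qadv land package; see the module docstring). -/
theorem ite_and_eq_toZ (p q : Bool) : (if p = true ∧ q = true then (1 : ZMod 2) else 0) = toZ (p && q) := by
  cases p <;> cases q <;> simp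

/-- the ROW VECTOR `M(x) β` of a bit family `β`: `(M(x) β)_j = β_{j-1} ⊕ β_{j+1} ⊕ x_j β_j` — the `𝔽₂`-span of the
rows of the game matrix is the STABILIZER of the relation: `⟨v, M(x) β⟩ = ⟨M(x) v, β⟩ = 0` for `v ∈ ker M(x)`. -/
def rowVec (x β : Fin N → Bool) (j : Fin N) : Bool := xor (xor (β (prv j)) (β (nxt j))) (x j && β j)

/-- StabilizerDialGaugeA helper `rowVec_xor` (decomp-qadv land package; see the module docstring). -/
theorem rowVec_xor (x β γ : Fin N → Bool) (j : Fin N) :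
    rowVec x (fun i => xor (β i) (γ i)) j = xor (rowVec x β j) (rowVec x γ j) := by
  have key : ∀ a b c a' b' c' y : Bool, xor (xor (xor a a') (xor b b')) (y && xor c c') =
      xor (xor (xor a b) (y && c)) (xor (xor a' b') (y && c')) := by decide
  exact key _ _ _ _ _ _ _

/-- StabilizerDialGaugeA helper `rowVec_false` (decomp-qadv land package; see the module docstring). -/
theorem rowVec_false (x : Fin N → Bool) (j : Fin N) : rowVec x (fun _ => false) j = false := by
  simp [rowVec]

/-- `∑_b [v_b ∧ (M(x)β)_b] = ∑_i β_i · (M(x) v)_i = 0` over `𝔽₂` for `v ∈ ker M(x)` (`M(x)` is symmetric). -/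
theorem sum_toZ_and_rowVec (x v β : Fin N → Bool) (hv : InKernel x v) :
    (∑ b, toZ (v b && rowVec x β b)) = 0 := by
  have hnx : Function.Bijective (nxt (n := N)) := Finite.injective_iff_bijective.mp nxt_injective
  have hpv : Function.Bijective (prv (n := N)) := Finite.injective_iff_bijective.mp prv_injective
  have e1 : (∑ b, toZ (v b) * toZ (β (prv b))) = ∑ i, toZ (v (nxt i)) * toZ (β i) :=
    (Fintype.sum_bijective _ hnx (fun i => toZ (v (nxt i)) * toZ (β i))
      (fun b => toZ (v b) * toZ (β (prv b))) (fun i => by rw [prv_nxt])).symm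
  have e2 : (∑ b, toZ (v b) * toZ (β (nxt b))) = ∑ i, toZ (v (prv i)) * toZ (β i) :=
    (Fintype.sum_bijective _ hpv (fun i => toZ (v (prv i)) * toZ (β i))
      (fun b => toZ (v b) * toZ (β (nxt b))) (fun i => by rw [nxt_prv])).symm
  have key : ∀ i, toZ (v (prv i)) + toZ (v (nxt i)) + toZ (x i) * toZ (v i) = 0 := fun i => by
    have h := congrArg toZ (hv i)
    simpa [toZ_xor, toZ_and, add_assoc] using h
  calc (∑ b, toZ (v b && rowVec x β b))
      = ∑ b, (toZ (v b) * toZ (β (prv b)) + toZ (v b) * toZ (β (nxt b)) +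
          toZ (v b) * (toZ (x b) * toZ (β b))) := by
        refine Finset.sum_congr rfl fun b _ => ?_
        simp only [rowVec, toZ_and, toZ_xor, mul_add]
    _ = (∑ b, toZ (v b) * toZ (β (prv b))) + (∑ b, toZ (v b) * toZ (β (nxt b))) +
          ∑ b, toZ (v b) * (toZ (x b) * toZ (β b)) := by
        rw [Finset.sum_add_distrib, Finset.sum_add_distrib]
    _ = (∑ i, toZ (v (nxt i)) * toZ (β i)) + (∑ i, toZ (v (prv i)) * toZ (β i)) +
          ∑ i, toZ (v i) * (toZ (x i) * toZ (β i)) := by rw [e1, e2]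
    _ = ∑ i, toZ (β i) * (toZ (v (prv i)) + toZ (v (nxt i)) + toZ (x i) * toZ (v i)) := by
        rw [← Finset.sum_add_distrib, ← Finset.sum_add_distrib]
        exact Finset.sum_congr rfl fun i _ => by ring
    _ = 0 := by simp [key]

/-- StabilizerDialGaugeA helper `natCast_card_filter_and` (decomp-qadv land package; see the module docstring). -/
theorem natCast_card_filter_and (v w : Fin N → Bool) :
    (((univ.filter fun b : Fin N => v b = true ∧ w b = true).card : ℕ) : ZMod 2) = ∑ b, toZ (v b && w b) := by
  rw [Finset.natCast_card_filter]
  exact Finset.sum_congr rfl fun b _ => ite_and_eq_toZ (v b) (w b)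

/-- padding the answer by a stabilizer row vector does not change any kernel parity `⟨v, z⟩`. -/
theorem dot2_rowPad (x v β z : Fin N → Bool) (hv : InKernel x v) :
    dot2 v (fun j => xor (z j) (rowVec x β j)) = dot2 v z := by
  unfold dot2
  refine (ZMod.natCast_eq_natCast_iff' _ _ 2).mp ?_
  rw [natCast_card_filter_and, natCast_card_filter_and]
  rw [show (∑ b, toZ (v b && xor (z b) (rowVec x β b))) = ∑ b, (toZ (v b && z b) + toZ (v b && rowVec x β b))
    from Finset.sum_congr rfl fun b _ => toZ_and_xor _ _ _, Finset.sum_add_distrib, sum_toZ_and_rowVec x v β hv,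
    add_zero]

/-- **THE STABILIZER-GAUGE LAW (bit level).**  For EVERY input `x` (odd or even) and every bit family `β`:
`z ⊕ M(x)β` is a valid answer iff `z` is.  The family `β` may depend on `x` in any way whatsoever. -/
theorem rel_rowPad_iff (x β z : Fin N → Bool) : Rel x (fun j => xor (z j) (rowVec x β j)) ↔ Rel x z := by
  unfold RingHLF.Rel
  exact forall_congr' fun v => imp_congr_right fun hv => by rw [dot2_rowPad x v β z hv]

/-! ## §2  The gauge at POLYNOMIAL level: `pad P s` (degree `2·deg P + 6·deg s + 1`), same win set, `dev ↦ dev △ M(x)s(x)` -/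

/-- bit read from an `𝔽₃`-valued cube function: `[f(x) = 1]`. -/
def bitP (f : CubeFn (ZMod 3) N) (x : Fin N → Bool) : Bool := decide (f x = 1)

/-- the bit family of a GAUGE `s` (one cube function per position) at input `x`. -/
def bits (s : Fin N → CubeFn (ZMod 3) N) (x : Fin N → Bool) : Fin N → Bool := fun i => bitP (s i) x

/-- the ROW MASK `M(x) s(x)` of the gauge `s` at `x`. -/
def rowMask (s : Fin N → CubeFn (ZMod 3) N) (x : Fin N → Bool) : Fin N → Bool := rowVec x (bits s x)

/-- the mask POLYNOMIAL at position `j`: `0/1`-valued, value `(M(x) s(x))_j`. -/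
def maskP (s : Fin N → CubeFn (ZMod 3) N) (j : Fin N) : CubeFn (ZMod 3) N :=
  xorP (xorP (selP (s (prv j))) (selP (s (nxt j)))) (mono (ZMod 3) {j} * selP (s j))

/-- **the PADDED STRATEGY** `pad P s`: answer bit `j` of `P`, XOR `(M(x) s(x))_j`. -/
def pad (P s : Fin N → CubeFn (ZMod 3) N) (j : Fin N) : CubeFn (ZMod 3) N := xorP (selP (P j)) (maskP s j)

/-- StabilizerDialGaugeA helper `selP_apply_bit` (decomp-qadv land package; see the module docstring). -/
theorem selP_apply_bit (f : CubeFn (ZMod 3) N) (x : Fin N → Bool) : selP f x = if bitP f x then 1 else 0 := by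
  rw [selP_apply]; unfold bitP
  by_cases h : f x = 1 <;> simp [h]

/-- StabilizerDialGaugeA helper `mono_mul_selP_apply` (decomp-qadv land package; see the module docstring). -/
theorem mono_mul_selP_apply (j : Fin N) (f : CubeFn (ZMod 3) N) (x : Fin N → Bool) :
    (mono (ZMod 3) {j} * selP f) x = if (x j && bitP f x) then 1 else 0 := by
  rw [Pi.mul_apply, mono_singleton_apply, selP_apply_bit]
  rcases Bool.eq_false_or_eq_true (x j) with h | h <;>
    rcases Bool.eq_false_or_eq_true (bitP f x) with h' | h' <;> simp [h, h']

/-- StabilizerDialGaugeA helper `maskP_apply` (decomp-qadv land package; see the module docstring). -/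
theorem maskP_apply (s : Fin N → CubeFn (ZMod 3) N) (j : Fin N) (x : Fin N → Bool) :
    maskP s j x = if rowMask s x j then 1 else 0 :=
  xorP_apply_bool _ _ x _ _ (xorP_apply_bool _ _ x _ _ (selP_apply_bit _ x) (selP_apply_bit _ x))
    (mono_mul_selP_apply j (s j) x)

/-- StabilizerDialGaugeA helper `pad_apply` (decomp-qadv land package; see the module docstring). -/
theorem pad_apply (P s : Fin N → CubeFn (ZMod 3) N) (j : Fin N) (x : Fin N → Bool) :
    pad P s j x = if xor (bitP (P j) x) (rowMask s x j) then 1 else 0 :=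
  xorP_apply_bool _ _ x _ _ (selP_apply_bit _ x) (maskP_apply s j x)

/-- StabilizerDialGaugeA helper `bitP_pad` (decomp-qadv land package; see the module docstring). -/
theorem bitP_pad (P s : Fin N → CubeFn (ZMod 3) N) (j : Fin N) (x : Fin N → Bool) :
    bitP (pad P s j) x = xor (bitP (P j) x) (rowMask s x j) := by
  show decide (pad P s j x = 1) = _
  rw [pad_apply]
  generalize xor (bitP (P j) x) (rowMask s x j) = q
  cases q <;> decide

/-- answers of the padded strategy = answers of `P` XOR the row mask. -/
theorem outB_pad (P s : Fin N → CubeFn (ZMod 3) N) (x : Fin N → Bool) :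
    outB (pad P s) x = fun j => xor (outB P x j) (rowMask s x j) :=
  funext fun j => bitP_pad P s j x

/-- **THE STABILIZER-GAUGE LAW (polynomial level)**: for EVERY input, `pad P s` wins iff `P` wins. -/
theorem rel_pad_iff (P s : Fin N → CubeFn (ZMod 3) N) (x : Fin N → Bool) :
    Rel x (outB (pad P s) x) ↔ Rel x (outB P x) := by
  rw [outB_pad]; exact rel_rowPad_iff x (bits s x) (outB P x)

/-- hence the win sets on the odd class coincide literally. -/
theorem winset_pad (P s : Fin N → CubeFn (ZMod 3) N) :
    (univ.filter fun x : Fin N → Bool => OddZeros x ∧ Rel x (fun i => decide (pad P s i x = 1))) =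
      univ.filter fun x : Fin N → Bool => OddZeros x ∧ Rel x (fun i => decide (P i x = 1)) :=
  Finset.filter_congr fun x _ => and_congr_right fun _ => rel_pad_iff P s x

/-- DEGREE: `deg (pad P s) ≤ 2·deg P + 6·deg s + 1`. -/
theorem maskP_mem {E : ℕ} {s : Fin N → CubeFn (ZMod 3) N} (hs : ∀ i, s i ∈ lowDeg (ZMod 3) N E) (j : Fin N) :
    maskP s j ∈ lowDeg (ZMod 3) N (6 * E + 1) :=
  lowDeg_mono (by omega) (xorP_mem (xorP_mem (selP_mem (hs _)) (selP_mem (hs _)))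
    (mul_mem_lowDeg_add (mono_mem_lowDeg (D := 1) (by simp)) (selP_mem (hs j))))

/-- StabilizerDialGaugeA helper `pad_mem` (decomp-qadv land package; see the module docstring). -/
theorem pad_mem {D E : ℕ} {P s : Fin N → CubeFn (ZMod 3) N} (hP : ∀ i, P i ∈ lowDeg (ZMod 3) N D)
    (hs : ∀ i, s i ∈ lowDeg (ZMod 3) N E) (j : Fin N) : pad P s j ∈ lowDeg (ZMod 3) N (2 * D + 6 * E + 1) :=
  lowDeg_mono (by omega) (xorP_mem (selP_mem (hP j)) (maskP_mem hs j))

/-- the row SET of the gauge at `x`. -/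
def rowSet (s : Fin N → CubeFn (ZMod 3) N) (x : Fin N → Bool) : Finset (Fin N) :=
  univ.filter fun j => rowMask s x j = true

/-- **DEVIATION SETS UNDER THE GAUGE**: `dev (pad P s) x = dev P x △ M(x)s(x)`. -/
theorem dev_pad (P s : Fin N → CubeFn (ZMod 3) N) (x : Fin N → Bool) :
    dev (pad P s) x = symmDiff (dev P x) (rowSet s x) := by
  ext j
  simp only [dev, rowSet, mem_filter, mem_univ, true_and, Finset.mem_symmDiff]
  rw [show decide (pad P s j x = 1) = xor (decide (P j x = 1)) (rowMask s x j) from bitP_pad P s j x]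
  generalize decide (P j x = 1) = a; generalize rowMask s x j = w; generalize tGuess x j = t
  cases a <;> cases w <;> cases t <;> simp

/-- `dev` and `FewLocus` depend on the strategy only through its answer bits. -/
theorem dev_congr {P Q : Fin N → CubeFn (ZMod 3) N} (h : ∀ x, outB P x = outB Q x) (x : Fin N → Bool) :
    dev P x = dev Q x := by
  ext i
  simp only [dev, mem_filter, mem_univ, true_and]
  have e := congrFun (h x) i
  simp only [outB] at e
  rw [e]

/-- StabilizerDialGaugeA helper `fewLocus_congr` (decomp-qadv land package; see the module docstring). -/
theorem fewLocus_congr {m r : ℕ} {P Q : Fin N → CubeFn (ZMod 3) N} (h : ∀ x, outB P x = outB Q x) :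
    FewLocus m r P ↔ FewLocus m r Q := by
  unfold FewLocus
  simp_rw [dev_congr h]


/-! ## §3  THE COLLAPSE OF g16's GENERIC SIDE: `ManyLocusLoss3 → PolyLossOddU3` (critic 69v16, made a theorem)

Pad ANY strategy by the constant COMB gauge `s_i = [i ≡ 1 (mod 4)]`: every even position `4 ≤ j ≤ N-2` is hit by
exactly one comb row for EVERY input, so `dev (pad P comb) x ⊇ teeth ∖ dev P x`; a coverable deviation set has
`≤ m(r+1)` elements, the teeth have `≥ (N-6)/2`, hence `dev P x` and `dev (pad P comb) x` are never BOTH coverable: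
on every input one of `P`, `pad P comb` is many-locus, so one of them is NOT few-locus (`log₂ N ≥ 3`), and `M` for that
one bounds the common win set. -/

/-- the constant COMB gauge. -/
def comb (i : Fin N) : CubeFn (ZMod 3) N := if i.val % 4 = 1 then 1 else 0

/-- StabilizerDialGaugeA helper `comb_mem` (decomp-qadv land package; see the module docstring). -/
theorem comb_mem (E : ℕ) (i : Fin N) : comb i ∈ lowDeg (ZMod 3) N E := by
  unfold comb
  split_ifs
  · exact one_mem_lowDeg E
  · exact Submodule.zero_mem _

/-- StabilizerDialGaugeA helper `bitP_comb` (decomp-qadv land package; see the module docstring). -/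
theorem bitP_comb (i : Fin N) (x : Fin N → Bool) : bitP (comb i) x = decide (i.val % 4 = 1) := by
  unfold bitP comb
  by_cases h : i.val % 4 = 1
  · simp [h]
  · simp only [h, if_false, Pi.zero_apply, decide_false]
    decide

/-- the TEETH: even positions `4 ≤ j`, `j + 2 ≤ N`. -/
def teeth : Finset (Fin N) := univ.filter fun j => 4 ≤ j.val ∧ j.val + 2 ≤ N ∧ j.val % 2 = 0

/-- StabilizerDialGaugeA helper `prv_val_of_pos` (decomp-qadv land package; see the module docstring). -/
theorem prv_val_of_pos (j : Fin N) (hj : 1 ≤ j.val) : (prv j).val = j.val - 1 := by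
  show (j.val + N - 1) % N = j.val - 1
  rw [show j.val + N - 1 = (j.val - 1) + N by omega, Nat.add_mod_right, Nat.mod_eq_of_lt (by omega)]

/-- StabilizerDialGaugeA helper `nxt_val_of_lt` (decomp-qadv land package; see the module docstring). -/
theorem nxt_val_of_lt (j : Fin N) (hj : j.val + 1 < N) : (nxt j).val = j.val + 1 := by
  show (j.val + 1) % N = j.val + 1
  exact Nat.mod_eq_of_lt hj

/-- on the teeth the comb's row mask is `1` for EVERY input. -/
theorem rowMask_comb_of_teeth {j : Fin N} (hj : j ∈ (teeth : Finset (Fin N))) (x : Fin N → Bool) :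
    rowMask comb x j = true := by
  simp only [teeth, mem_filter, mem_univ, true_and] at hj
  obtain ⟨h4, h2, he⟩ := hj
  have hp : (prv j).val = j.val - 1 := prv_val_of_pos j (by omega)
  have hn : (nxt j).val = j.val + 1 := nxt_val_of_lt j (by omega)
  show xor (xor (bitP (comb (prv j)) x) (bitP (comb (nxt j)) x)) (x j && bitP (comb j) x) = true
  rw [bitP_comb, bitP_comb, bitP_comb, hp, hn]
  have hj1 : ¬ (j.val % 4 = 1) := by omega
  rcases (show j.val % 4 = 0 ∨ j.val % 4 = 2 by omega) with h | h
  · have a : ¬ ((j.val - 1) % 4 = 1) := by omega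
    have b : (j.val + 1) % 4 = 1 := by omega
    simp [a, b, hj1]
  · have a : (j.val - 1) % 4 = 1 := by omega
    have b : ¬ ((j.val + 1) % 4 = 1) := by omega
    simp [a, b, hj1]

/-- StabilizerDialGaugeA helper `le_card_teeth` (decomp-qadv land package; see the module docstring). -/
theorem le_card_teeth (K : ℕ) (hK : 2 * K + 6 ≤ N) : K ≤ (teeth : Finset (Fin N)).card := by
  let f : Fin K → Fin N := fun k => ⟨4 + 2 * k.val, by omega⟩
  have hf : Function.Injective f := fun a b h => by
    have := congrArg Fin.val h
    simp only [f] at this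
    exact Fin.ext (by omega)
  calc K = (univ.image f).card := by rw [Finset.card_image_of_injective _ hf, Finset.card_univ, Fintype.card_fin]
    _ ≤ (teeth : Finset (Fin N)).card := Finset.card_le_card (by
        intro j hj
        simp only [mem_image, mem_univ, true_and] at hj
        obtain ⟨k, rfl⟩ := hj
        simp only [teeth, mem_filter, mem_univ, true_and, f]
        omega)


end Summit.QuantumAdvantage.QuantumAdvantage.Theorems.StabilizerDial
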